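import Mathlib
import HarnessLib
import Summits.QuantumFields.YangMills.Theses.GuardedThresholdRemoval
import Literature.MathematicalPhysics.QuantumFieldTheory.Balaban1983to89.BlockAveragingExpMeanLogContinuous

/-!
# GuardedThresholdRemoval — the THIN-SET LÉVY–CAUCHY TRANSFER `ThinLevyCauchy` (LINE g7-C/D of ideator seat ym-idea-1)

Route `route-QuantumFields-GuardedThresholdRemoval` (closes rung R3 `T3YM3TorusStatement.YM3Torus(Matrix.specialUnitaryGroup (Fin 2) ℂ)` BY NAME; no summit is proved by this
line) splits its transfer crux `GuardedTransfer` (stmt-QuantumFields-28026) into `ThinLevyCauchy` and `CoarseObsContinuousOffGuard` (glue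
`Theorems/GuardedThresholdRemovalTransferSplitGlue`).  This file PROVES `ThinLevyCauchy`: for every three-torus family `F` and `γ ≥ 0`, if
the unit laws `ν_K` are thin at the guard spheres `{dist₁(W_{c,i}) = δ}` of the printed averaging and the scheme strings converge
(`HasContinuumLimit`), then `∫ h dν_K` converges for EVERY measurable gauge-invariant `h`, `|h| ≤ 1`, continuous at every configuration
off the guard spheres.
RESTRICT-THEN-TIGHTEN: §2 builds a continuous gauge-invariant cut-off `φ_η = ∏_{c,i} ψ_η(|dist₁(W_{c,i}) − δ|)` of the `η`-collar
(`= 1` off the collar, `= 0` where some `|dist₁ − δ| ≤ η/2`); `h·φ_η` is continuous EVERYWHERE (zero near the deep collar, a product of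
functions continuous at `U` elsewhere), invariant (`loopHol_gaugeAct`, `dist1_conj`), measurable and bounded, so §1 — the Lévy upgrade
«loop strings converge ⇒ integrals of continuous invariant observables converge», ported verbatim from the tree's `ℰc` node
`T3ThresholdRemoval.exists_tendsto_integral_unitLaw` to `ℰp` ([Levy2004] Thm 3.1 via tree `LevyDensity.dense_su2_of_connected`) — gives
convergence of `∫ h φ_η dν_K`; TIGHTEN: `|∫ h − ∫ h φ_η| ≤ ν_K(collar_η) ≤ ε` for `K ≥ K₀` by thinness, so `∫ h dν_K` is Cauchy (§0, an
«eventually» form of the tree's private ε/3 lemma).  No weak-limit measure, no Tietze extension, no gauge averaging.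
-/

open MeasureTheory Filter Topology
open Literature.MathematicalPhysics.QuantumFieldTheory.Balaban1983to89
open Literature.MathematicalPhysics.QuantumFieldTheory.Balaban1983to89.Missing
open Literature.MathematicalPhysics.QuantumFieldTheory.Balaban1983to89.T3ContinuumYM3Torus
open Literature.MathematicalPhysics.QuantumFieldTheory.Balaban1983to89.T3LevelShift
open Literature.MathematicalPhysics.QuantumFieldTheory.Balaban1983to89.T3ThresholdRemoval
open Literature.MathematicalPhysics.QuantumFieldTheory.Balaban1983to89.T4Continuum
open Literature.MathematicalPhysics.QuantumFieldTheory.Balaban1983to89.T3UnitLawDensityEML (ℰp measurableE_ℰp)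

namespace Summit.QuantumFields.YangMills.Theses.GuardedThresholdRemoval

/-! ## §0 helpers (the tree's are private) -/

/-- A real sequence which, to every accuracy, is EVENTUALLY uniformly close to a convergent sequence converges. [folklore] -/
theorem exists_tendsto_of_forall_eventually_approx {a : ℕ → ℝ}
    (h : ∀ ε > 0, ∃ b : ℕ → ℝ, (∃ l, Tendsto b atTop (𝓝 l)) ∧ ∃ K₀ : ℕ, ∀ K, K₀ ≤ K → |a K - b K| ≤ ε) :
    ∃ l, Tendsto a atTop (𝓝 l) := by
  apply cauchySeq_tendsto_of_complete
  rw [Metric.cauchySeq_iff]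
  intro ε hε
  obtain ⟨b, ⟨l, hb⟩, K₀, hab⟩ := h (ε / 3) (by positivity)
  obtain ⟨N, hN⟩ := Metric.cauchySeq_iff.mp hb.cauchySeq (ε / 3) (by positivity)
  refine ⟨max N K₀, fun p hp q hq => ?_⟩
  have h1 := hab p (le_of_max_le_right hp)
  have h2 := hab q (le_of_max_le_right hq)
  have h3 := hN p (le_of_max_le_left hp) q (le_of_max_le_left hq)
  rw [Real.dist_eq] at h3 ⊢
  calc |a p - a q| = |(a p - b p) + (b p - b q) + (b q - a q)| := by ring_nf
    _ ≤ |a p - b p| + |b p - b q| + |b q - a q| := abs_add_three _ _ _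
    _ < ε := by rw [abs_sub_comm (b q) (a q)]; linarith

/-- Products of a list of measurable real functions are measurable. [folklore] -/
theorem measurable_list_prod' {X : Type*} [MeasurableSpace X] {ι : Type*} (f : ι → X → ℝ)
    (hf : ∀ i, Measurable (f i)) : ∀ l : List ι, Measurable fun x => (l.map fun i => f i x).prod
  | [] => by simp
  | i :: l => by
    show Measurable fun x => f i x * (l.map fun i => f i x).prod
    exact (hf i).mul (measurable_list_prod' f hf l)

/-- Products of a list of functions bounded by `1` are bounded by `1`. [folklore] -/
theorem abs_list_prod_le_one' {X : Type*} {ι : Type*} (f : ι → X → ℝ) (hf : ∀ i x, |f i x| ≤ 1) (x : X) :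
    ∀ l : List ι, |(l.map fun i => f i x).prod| ≤ 1
  | [] => by simp
  | i :: l => by
    rw [List.map_cons, List.prod_cons, abs_mul]
    exact mul_le_one₀ (hf i x) (abs_nonneg _) (abs_list_prod_le_one' f hf x l)

/-- Convergence of integrals against probability laws passes to the linear span of a class of bounded measurable functions. [folklore] -/
theorem tendsto_integral_of_mem_span' {X : Type*} [MeasurableSpace X] (μ : ℕ → Measure X)
    [∀ K, IsProbabilityMeasure (μ K)] {S : Set (X → ℝ)}
    (hS : ∀ q ∈ S, (∃ B, ∀ u, |q u| ≤ B) ∧ Measurable q ∧ ∃ l, Tendsto (fun K => ∫ u, q u ∂μ K) atTop (𝓝 l))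
    {p : X → ℝ} (hp : p ∈ Submodule.span ℝ S) :
    (∃ B, ∀ u, |p u| ≤ B) ∧ Measurable p ∧ ∃ l, Tendsto (fun K => ∫ u, p u ∂μ K) atTop (𝓝 l) := by
  induction hp using Submodule.span_induction with
  | mem q hq => exact hS q hq
  | zero => exact ⟨⟨0, fun u => by simp⟩, measurable_const, ⟨0, by simp⟩⟩
  | add p q _ _ hp hq =>
    obtain ⟨⟨Bp, hBp⟩, hpm, lp, hlp⟩ := hp
    obtain ⟨⟨Bq, hBq⟩, hqm, lq, hlq⟩ := hq
    refine ⟨⟨Bp + Bq, fun u => (abs_add_le _ _).trans (add_le_add (hBp u) (hBq u))⟩, hpm.add hqm, ⟨lp + lq, ?_⟩⟩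
    have he : (fun K => ∫ u, (p + q) u ∂μ K) = fun K => ∫ u, p u ∂μ K + ∫ u, q u ∂μ K := funext fun K =>
      integral_add (T4VarianceMatching.integrable_of_abs_le (μ K) hpm hBp)
        (T4VarianceMatching.integrable_of_abs_le (μ K) hqm hBq)
    rw [he]
    exact hlp.add hlq
  | smul a p _ hp =>
    obtain ⟨⟨Bp, hBp⟩, hpm, lp, hlp⟩ := hp
    refine ⟨⟨|a| * Bp, fun u => ?_⟩, hpm.const_mul a, ⟨a * lp, ?_⟩⟩
    · rw [Pi.smul_apply, smul_eq_mul, abs_mul]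
      exact mul_le_mul_of_nonneg_left (hBp u) (abs_nonneg a)
    · have he : (fun K => ∫ u, (a • p) u ∂μ K) = fun K => a * ∫ u, p u ∂μ K := funext fun K => by
        simp only [Pi.smul_apply, smul_eq_mul]
        exact integral_const_mul a _
      rw [he]
      exact hlp.const_mul a

/-! ## §1 Lévy upgrade at the PRINTED averaging `ℰp` (port of tree `exists_tendsto_integral_unitLaw` from `ℰc`) -/

open Literature.MathematicalPhysics.QuantumLattice in
/-- **Existence of the continuum limit propagates from loop strings to every continuous gauge-invariant unit-lattice observable**, at
the printed averaging `ℰp` (`SU(2)`): Lévy density of the Wilson-loop algebra + ε/3, verbatim as the tree's `ℰc` node. [cite: Levy2004, Thm 3.1] -/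
theorem exists_tendsto_integral_unitLaw_p (F : T3Family) {γ : ℝ} (hγ : 0 ≤ γ) (h : HasContinuumLimit (F.scheme ℰp γ))
    {f : GaugeField (F.P 0) 0 (Matrix.specialUnitaryGroup (Fin 2) ℂ) → ℝ} (hfc : Continuous f)
    (hfi : ∀ (u : GaugeTransf (F.P 0) 0 (Matrix.specialUnitaryGroup (Fin 2) ℂ)) (U : GaugeField (F.P 0) 0 (Matrix.specialUnitaryGroup (Fin 2) ℂ)), f (GaugeField.gaugeAct u U) = f U)
    (hfm : Measurable f) {B : ℝ} (hfb : ∀ u, |f u| ≤ B) :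
    ∃ l, Tendsto (fun K => ∫ u, f u ∂F.unitLaw ℰp measurableE_ℰp γ K) atTop (𝓝 l) := by
  let μ : ℕ → Measure (GaugeField (F.P 0) 0 (Matrix.specialUnitaryGroup (Fin 2) ℂ)) := fun K => F.unitLaw ℰp measurableE_ℰp γ K
  haveI : ∀ K, IsProbabilityMeasure (μ K) := fun K => isProbabilityMeasure_unitLaw measurableE_ℰp hγ K
  have hgen : ∀ q ∈ LevyDensity.loopTraceProducts (PBond.src (P := F.P 0) (j := 0)) PBond.tgt (fundamentalRep (Fin 2))
      (0 : F.USite), (∃ B, ∀ u, |q u| ≤ B) ∧ Measurable q ∧ ∃ l, Tendsto (fun K => ∫ u, q u ∂μ K) atTop (𝓝 l) := by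
    rintro q ⟨l, rfl⟩
    obtain ⟨c, Cs, hq⟩ := loopTraceProduct_eq_string (F := F) l
    rw [hq]
    refine ⟨⟨|c|, fun u => ?_⟩, (measurable_list_prod'
      (fun (C : ULoop3 F) (u : GaugeField (F.P 0) 0 (Matrix.specialUnitaryGroup (Fin 2) ℂ)) => loopAt u (C.1.atLevel 0))
      (fun C => measurable_loopAt _) Cs).const_mul c, ?_⟩
    · rw [abs_mul]
      exact mul_le_of_le_one_right (abs_nonneg c) (abs_list_prod_le_one'
        (fun (C : ULoop3 F) (u : GaugeField (F.P 0) 0 (Matrix.specialUnitaryGroup (Fin 2) ℂ)) => loopAt u (C.1.atLevel 0))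
        (fun _ _ => abs_loopAt_le_one _ _) u Cs)
    · obtain ⟨l₀, hl₀⟩ := h Cs
      refine ⟨c * l₀, ?_⟩
      have he : (fun K => ∫ u, c * (Cs.map fun C => loopAt u (C.1.atLevel 0)).prod ∂μ K) =
          fun K => c * (F.scheme ℰp γ).expectAt K Cs := funext fun K => by
        rw [integral_const_mul, expectAt_eq_integral_unitLaw measurableE_ℰp hγ K Cs]
      rw [he]
      exact hl₀.const_mul c
  refine exists_tendsto_of_forall_eventually_approx fun ε hε => ?_
  obtain ⟨p, hp, hfp⟩ := LevyDensity.dense_su2_of_connected (PBond.src (P := F.P 0) (j := 0)) PBond.tgt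
    (v₀ := (0 : F.USite)) exists_isPath_zero (F := f) hfc hfi hε
  obtain ⟨⟨B', hB'⟩, hpm, l, hl⟩ := tendsto_integral_of_mem_span' μ hgen hp
  refine ⟨fun K => ∫ u, p u ∂μ K, ⟨l, hl⟩, 0, fun K _ => ?_⟩
  rw [← integral_sub (T4VarianceMatching.integrable_of_abs_le (μ K) hfm hfb)
    (T4VarianceMatching.integrable_of_abs_le (μ K) hpm hB')]
  have hb := norm_integral_le_of_norm_le_const (μ := μ K) (f := fun u => f u - p u) (C := ε)
    (Eventually.of_forall fun u => by simpa [Real.norm_eq_abs] using hfp u)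
  simpa [Real.norm_eq_abs] using hb

/-! ## §2 The continuous gauge-invariant cut-off of the guard collar -/

section Cut

variable (F : T3Family)

/-- the clamp `ψ_η(t) = max 0 (min 1 ((t − η/2)/(η/2)))`: `0` for `t ≤ η/2`, `1` for `t ≥ η`. [folklore] -/
noncomputable def clampη (η t : ℝ) : ℝ := max 0 (min 1 ((t - η / 2) / (η / 2)))

/-- `clampη_nonneg` (elementary bookkeeping for the cut-off / Cauchy argument). [folklore] -/
theorem clampη_nonneg (η t : ℝ) : 0 ≤ clampη η t := le_max_left _ _

/-- `clampη_le_one` (elementary bookkeeping for the cut-off / Cauchy argument). [folklore] -/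
theorem clampη_le_one (η t : ℝ) : clampη η t ≤ 1 :=
  max_le zero_le_one (min_le_left _ _)

/-- `clampη_eq_one` (elementary bookkeeping for the cut-off / Cauchy argument). [folklore] -/
theorem clampη_eq_one {η t : ℝ} (hη : 0 < η) (ht : η ≤ t) : clampη η t = 1 := by
  unfold clampη
  have h2 : 0 < η / 2 := by positivity
  have : 1 ≤ (t - η / 2) / (η / 2) := by
    rw [le_div_iff₀ h2]; linarith
  rw [min_eq_left this, max_eq_right zero_le_one]

/-- `clampη_eq_zero` (elementary bookkeeping for the cut-off / Cauchy argument). [folklore] -/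
theorem clampη_eq_zero {η t : ℝ} (hη : 0 < η) (ht : t ≤ η / 2) : clampη η t = 0 := by
  unfold clampη
  have h2 : 0 < η / 2 := by positivity
  have : (t - η / 2) / (η / 2) ≤ 0 := div_nonpos_of_nonpos_of_nonneg (by linarith) h2.le
  exact max_eq_left ((min_le_right _ _).trans this)

/-- `continuous_clampη` (elementary bookkeeping for the cut-off / Cauchy argument). [folklore] -/
theorem continuous_clampη (η : ℝ) : Continuous (clampη η) := by
  unfold clampη
  fun_prop

/-- the guard distance of the block loop `(c, i)`: `|dist₁(W_{c,i}(U)) − δ|`. [folklore] -/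
noncomputable def guardDist (U : GaugeField (F.P 0) 0 (Matrix.specialUnitaryGroup (Fin 2) ℂ)) (ci : PBond (F.P 0) 1 × BlockAveraging.Idx (F.P 0)) : ℝ :=
  |dist1 (BlockAveraging.loopHol U ci.1 ci.2) - (ℰp).δ|

/-- the cut-off `φ_η(U) = ∏_{c,i} ψ_η(|dist₁(W_{c,i}(U)) − δ|)`. [folklore] -/
noncomputable def guardCut (η : ℝ) (U : GaugeField (F.P 0) 0 (Matrix.specialUnitaryGroup (Fin 2) ℂ)) : ℝ :=
  ∏ ci : PBond (F.P 0) 1 × BlockAveraging.Idx (F.P 0), clampη η (guardDist F U ci)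

/-- `continuous_guardDist` (elementary bookkeeping for the cut-off / Cauchy argument). [folklore] -/
theorem continuous_guardDist (ci : PBond (F.P 0) 1 × BlockAveraging.Idx (F.P 0)) : Continuous fun U => guardDist F U ci := by
  unfold guardDist
  have h1 : Continuous fun U : GaugeField (F.P 0) 0 (Matrix.specialUnitaryGroup (Fin 2) ℂ) => BlockAveraging.loopHol U ci.1 ci.2 :=
    (continuous_apply ci.2).comp (BlockAveraging.continuous_loopHol ci.1)
  have h2 : Continuous (dist1 : (Matrix.specialUnitaryGroup (Fin 2) ℂ) → ℝ) :=
    UnitaryModel.continuous_opDist1.comp (Literature.MathematicalPhysics.QuantumLattice.continuous_fundamentalRep (Fin 2))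
  exact ((h2.comp h1).sub continuous_const).abs

/-- `measurable_guardDist` (elementary bookkeeping for the cut-off / Cauchy argument). [folklore] -/
theorem measurable_guardDist (ci : PBond (F.P 0) 1 × BlockAveraging.Idx (F.P 0)) : Measurable fun U => guardDist F U ci := by
  unfold guardDist
  have h1 : Measurable fun U : GaugeField (F.P 0) 0 (Matrix.specialUnitaryGroup (Fin 2) ℂ) => BlockAveraging.loopHol U ci.1 ci.2 :=
    (measurable_pi_apply ci.2).comp (BlockAveraging.measurable_loopHol ci.1)
  exact ((RegularGaugeGroup.measurable_dist1.comp h1).sub measurable_const).abs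

/-- `guardDist_gaugeAct` (elementary bookkeeping for the cut-off / Cauchy argument). [folklore] -/
theorem guardDist_gaugeAct (g : GaugeTransf (F.P 0) 0 (Matrix.specialUnitaryGroup (Fin 2) ℂ)) (U : GaugeField (F.P 0) 0 (Matrix.specialUnitaryGroup (Fin 2) ℂ))
    (ci : PBond (F.P 0) 1 × BlockAveraging.Idx (F.P 0)) : guardDist F (GaugeField.gaugeAct g U) ci = guardDist F U ci := by
  unfold guardDist
  rw [BlockAveraging.loopHol_gaugeAct, GaugeGroup.dist1_conj]

/-- `continuous_guardCut` (elementary bookkeeping for the cut-off / Cauchy argument). [folklore] -/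
theorem continuous_guardCut (η : ℝ) : Continuous (guardCut F η) :=
  continuous_finsetProd _ fun ci _ => (continuous_clampη η).comp (continuous_guardDist F ci)

/-- `measurable_guardCut` (elementary bookkeeping for the cut-off / Cauchy argument). [folklore] -/
theorem measurable_guardCut (η : ℝ) : Measurable (guardCut F η) :=
  Finset.measurable_prod _ fun ci _ => (continuous_clampη η).measurable.comp (measurable_guardDist F ci)

/-- `guardCut_gaugeAct` (elementary bookkeeping for the cut-off / Cauchy argument). [folklore] -/
theorem guardCut_gaugeAct (η : ℝ) (g : GaugeTransf (F.P 0) 0 (Matrix.specialUnitaryGroup (Fin 2) ℂ)) (U : GaugeField (F.P 0) 0 (Matrix.specialUnitaryGroup (Fin 2) ℂ)) :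
    guardCut F η (GaugeField.gaugeAct g U) = guardCut F η U := by
  unfold guardCut
  simp_rw [guardDist_gaugeAct]

/-- `guardCut_nonneg` (elementary bookkeeping for the cut-off / Cauchy argument). [folklore] -/
theorem guardCut_nonneg (η : ℝ) (U : GaugeField (F.P 0) 0 (Matrix.specialUnitaryGroup (Fin 2) ℂ)) : 0 ≤ guardCut F η U :=
  Finset.prod_nonneg fun _ _ => clampη_nonneg _ _

/-- `guardCut_le_one` (elementary bookkeeping for the cut-off / Cauchy argument). [folklore] -/
theorem guardCut_le_one (η : ℝ) (U : GaugeField (F.P 0) 0 (Matrix.specialUnitaryGroup (Fin 2) ℂ)) : guardCut F η U ≤ 1 :=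
  Finset.prod_le_one (fun _ _ => clampη_nonneg _ _) fun _ _ => clampη_le_one _ _

/-- off the `η`-collar the cut-off is `1`. [folklore] -/
theorem guardCut_eq_one {η : ℝ} (hη : 0 < η) {U : GaugeField (F.P 0) 0 (Matrix.specialUnitaryGroup (Fin 2) ℂ)} (hU : ∀ ci, η ≤ guardDist F U ci) :
    guardCut F η U = 1 :=
  Finset.prod_eq_one fun ci _ => clampη_eq_one hη (hU ci)

/-- deep inside the collar (`|dist₁ − δ| ≤ η/2` for some block loop) the cut-off is `0`. [folklore] -/
theorem guardCut_eq_zero {η : ℝ} (hη : 0 < η) {U : GaugeField (F.P 0) 0 (Matrix.specialUnitaryGroup (Fin 2) ℂ)} {ci : PBond (F.P 0) 1 × BlockAveraging.Idx (F.P 0)}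
    (hU : guardDist F U ci ≤ η / 2) : guardCut F η U = 0 :=
  Finset.prod_eq_zero (Finset.mem_univ ci) (clampη_eq_zero hη hU)

end Cut

/-! ## §3 The thin-set Lévy–Cauchy transfer -/

/-- **`ThinLevyCauchy` holds** (split child of `GuardedTransfer`, stmt-QuantumFields-28026, route GuardedThresholdRemoval): thin unit laws at
the guard spheres + convergent loop strings ⇒ convergent integrals of every bounded measurable gauge-invariant observable continuous off
the guard spheres. [cite: Levy2004, Thm 3.1] -/
theorem thinLevyCauchy_holds : ThinLevyCauchy := by
  intro F γ hγ hthin hHC h hm hb hinv hcont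
  -- write the conclusion with the integral notation
  show ∃ l : ℝ, Tendsto (fun K => ∫ u, h u ∂F.unitLaw ℰp measurableE_ℰp γ K) atTop (𝓝 l)
  let μ : ℕ → Measure (GaugeField (F.P 0) 0 (Matrix.specialUnitaryGroup (Fin 2) ℂ)) := fun K => F.unitLaw ℰp measurableE_ℰp γ K
  haveI hμ : ∀ K, IsProbabilityMeasure (μ K) := fun K => isProbabilityMeasure_unitLaw measurableE_ℰp hγ K
  refine exists_tendsto_of_forall_eventually_approx fun ε hε => ?_
  obtain ⟨η, hη, K₀, hK⟩ := hthin ε hε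
  -- the continuous invariant approximant `f = h · φ_η`
  let f : GaugeField (F.P 0) 0 (Matrix.specialUnitaryGroup (Fin 2) ℂ) → ℝ := fun U => h U * guardCut F η U
  have hfc : Continuous f := by
    refine continuous_iff_continuousAt.mpr fun U => ?_
    by_cases hcase : ∃ ci, guardDist F U ci < η / 2
    · -- deep inside the collar: `f = 0` near `U`
      obtain ⟨ci, hci⟩ := hcase
      have hopen : ∀ᶠ V in 𝓝 U, guardDist F V ci < η / 2 :=
        (continuous_guardDist F ci).continuousAt.eventually_lt continuousAt_const hci
      have hzero : ∀ᶠ V in 𝓝 U, f V = 0 := hopen.mono fun V hV => by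
        show h V * guardCut F η V = 0
        rw [guardCut_eq_zero F hη hV.le, mul_zero]
      have hfU : f U = 0 := by
        show h U * guardCut F η U = 0
        rw [guardCut_eq_zero F hη hci.le, mul_zero]
      rw [ContinuousAt, hfU]
      exact tendsto_const_nhds.congr' (hzero.mono fun V hV => hV.symm)
    · -- away from the spheres: `h` is continuous at `U`
      push Not at hcase
      have hoff : ∀ (c : PBond (F.P 0) 1) (i : BlockAveraging.Idx (F.P 0)),
          dist1 (BlockAveraging.loopHol U c i) ≠ (ℰp).δ := fun c i hci => by
        have := hcase (c, i)
        simp only [guardDist, hci, sub_self, abs_zero] at this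
        linarith
      exact (hcont U hoff).mul (continuous_guardCut F η).continuousAt
  have hfi : ∀ (g : GaugeTransf (F.P 0) 0 (Matrix.specialUnitaryGroup (Fin 2) ℂ)) (U : GaugeField (F.P 0) 0 (Matrix.specialUnitaryGroup (Fin 2) ℂ)), f (GaugeField.gaugeAct g U) = f U :=
    fun g U => by
      show h (GaugeField.gaugeAct g U) * guardCut F η (GaugeField.gaugeAct g U) = h U * guardCut F η U
      rw [hinv, guardCut_gaugeAct]
  have hfm : Measurable f := hm.mul (measurable_guardCut F η)
  have hfb : ∀ u, |f u| ≤ 1 := fun u => by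
    show |h u * guardCut F η u| ≤ 1
    rw [abs_mul, abs_of_nonneg (guardCut_nonneg F η u)]
    exact mul_le_one₀ (hb u) (guardCut_nonneg F η u) (guardCut_le_one F η u)
  obtain ⟨l, hl⟩ := exists_tendsto_integral_unitLaw_p F hγ hHC hfc hfi hfm hfb
  refine ⟨fun K => ∫ u, f u ∂μ K, ⟨l, hl⟩, K₀, fun K hKK => ?_⟩
  -- `|∫ h − ∫ f| ≤ ∫ |h − f| ≤ μ_K(collar_η) ≤ ε`
  let Sη : Set (GaugeField (F.P 0) 0 (Matrix.specialUnitaryGroup (Fin 2) ℂ)) :=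
    {u | ∃ (c : PBond (F.P 0) 1) (i : BlockAveraging.Idx (F.P 0)), |dist1 (BlockAveraging.loopHol u c i) - (ℰp).δ| < η}
  have hSmeas : MeasurableSet Sη := by
    have : Sη = ⋃ ci : PBond (F.P 0) 1 × BlockAveraging.Idx (F.P 0), {u | guardDist F u ci < η} := by
      ext u
      simp only [Sη, guardDist, Set.mem_setOf_eq, Set.mem_iUnion, Prod.exists]
    rw [this]
    exact MeasurableSet.iUnion fun ci => measurableSet_lt (measurable_guardDist F ci) measurable_const
  have hptw : ∀ u, |h u - f u| ≤ Sη.indicator (fun _ => (1 : ℝ)) u := fun u => by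
    by_cases hu : u ∈ Sη
    · rw [Set.indicator_of_mem hu]
      show |h u - h u * guardCut F η u| ≤ 1
      have : h u - h u * guardCut F η u = h u * (1 - guardCut F η u) := by ring
      rw [this, abs_mul, abs_of_nonneg (sub_nonneg.mpr (guardCut_le_one F η u))]
      exact mul_le_one₀ (hb u) (sub_nonneg.mpr (guardCut_le_one F η u)) (sub_le_self _ (guardCut_nonneg F η u))
    · rw [Set.indicator_of_notMem hu]
      have hU : ∀ ci, η ≤ guardDist F u ci := fun ci => by
        by_contra hlt
        exact hu ⟨ci.1, ci.2, not_le.mp hlt⟩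
      show |h u - h u * guardCut F η u| ≤ 0
      rw [guardCut_eq_one F hη hU, mul_one, sub_self, abs_zero]
  have hint_h : Integrable h (μ K) := T4VarianceMatching.integrable_of_abs_le (μ K) hm hb
  have hint_f : Integrable f (μ K) := T4VarianceMatching.integrable_of_abs_le (μ K) hfm hfb
  calc |∫ u, h u ∂μ K - ∫ u, f u ∂μ K|
      = |∫ u, (h u - f u) ∂μ K| := by rw [integral_sub hint_h hint_f]
    _ ≤ ∫ u, |h u - f u| ∂μ K := abs_integral_le_integral_abs
    _ ≤ ∫ u, Sη.indicator (fun _ => (1 : ℝ)) u ∂μ K := by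
        refine integral_mono_of_nonneg (Eventually.of_forall fun u => abs_nonneg _) ?_ (Eventually.of_forall hptw)
        exact (integrable_const (1 : ℝ)).indicator hSmeas
    _ = (μ K).real Sη := by
        rw [integral_indicator hSmeas, setIntegral_const, smul_eq_mul, mul_one]
    _ ≤ ε := hK K hKK

end Summit.QuantumFields.YangMills.Theses.GuardedThresholdRemoval
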